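import Literature.Probability.RandomPlanarGeometry.StarHullOneStep
import Literature.Probability.RandomPlanarGeometry.BrownianBubbles
import HarnessLib

/-!
# One step of the flow moves the Schwarzian mass `−SE_B(0)/6` by `O(u + η)` ([LSW] Prop. 5.3: the compensator is continuous along the flow)

Complement to `StarHullOneStep` (one-step expansion of `Φ′_B(0)`), after

* G. F. Lawler, O. Schramm, W. Werner, *Conformal restriction: the chordal case*, J. Amer. Math.
  Soc. **16** (2003) 917–955, arXiv:math/0209343 (**[LSW]**), §5 (5.1)–(5.3) and Prop. 5.3:
  `Y_t = h_t′(W_t)^α exp(λ ∫₀ᵗ Sh_s(W_s)/6 ds)` — the compensator integrates the Schwarzian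
  mass `−Sh_s(W_s)/6` ALONG the flow, so a conditional-increment proof of its martingale
  property needs the modulus of continuity of `s ↦ −Sh_s(W_s)/6` over one step;
* G. F. Lawler, *Conformally Invariant Processes in the Plane* (2005), §4.6.1 (the jets of `h_t`
  at `W_t` are `C¹` in `t`, (4.35)–(4.37)).

For a `*`-hull `B` in the controlled class (`δ₀ ≤ d = Φ′_B(0)`, `B` off `B(0, 8ρ₀)`) and one step
of the Loewner flow (`B′ = slidHull U B u`, `x = U_u`, `η = stepSize S u ≤ d ρ₀/1000`), in terms
of the canonical real jets `d = starDeriv`, `c₂ = starJet2 = E″(0)`, `c₃ = starJet3 = E‴(0)` and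
the mass `m(B) = bubbleMass d (c₂/2) (c₃/6) = c₂²/(4d²) − c₃/(6d) = −SE_B(0)/6`
(`BrownianBubbles.bubbleMass`; this is `starBubbleMass B` of `SLEBubblesSchwarzianMass`), we PROVE:

* `Loewner.abs_starJet2_slidHull_sub_le` — `|c₂′ − c₂| ≤ 200u/ρ₀³ + 2|x|/ρ₀²`
  (`norm_deriv2_starStep_le` at `z = x`, plus the shift `|E″(x) − E″(0)| ≤ (2/ρ₀²)|x|`);
* `Loewner.abs_starJet3_slidHull_sub_le` — `|c₃′ − c₃| ≤ 1600u/ρ₀⁴ + 8|x|/ρ₀³`;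
* `Loewner.abs_schwarzMass_le` — `|m(B)| ≤ 1/(4 δ₀² ρ₀²) + 1/(3 δ₀ ρ₀²)` on the controlled class;
* **`Loewner.abs_schwarzMass_slidHull_sub_le`** — `|m(B′) − m(B)| ≤ massStepC δ₀ ρ₀ · (u + η)`
  with an explicit `massStepC δ₀ ρ₀` (uniform on the controlled class), from the three jet
  increments (`|d′ − d| ≤ 50u/ρ₀² + 2η/ρ₀`, `abs_starDeriv_sub_le_crude`) and the Lipschitz
  continuity of `(d, c₂, c₃) ↦ c₂²/(4d²) − c₃/(6d)` on `d ≥ δ₀/2`, `|c₂| ≤ 2/ρ₀`, `|c₃| ≤ 4/ρ₀²`.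

Hence along a controlled stretch of the flow `|∫ₜ^{t+u} m − u·m_t| ≤ massStepC · u (u + η)`,
the input of the compensated one-step expansion of `Y`.

## References

* [LSW] §5 (5.1)–(5.3), Prop. 5.3. [LawlerSchrammWerner2003Restriction]
* Lawler (2005), §4.6.1 (4.35)–(4.37), Prop. 4.40. [Lawler2005]
-/

noncomputable section

open Set Filter Metric Function
open _root_.Complex _root_.Topology _root_.Real
open UpperHalfPlane (upperHalfPlaneSet)
open scoped NNReal

namespace Literature.Probability.RandomPlanarGeometry

namespace Loewner

variable {B : Set ℂ} {ρ₀ : ℝ} {U : ℝ≥0 → ℝ} {u : ℝ≥0} {S : ℝ}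
variable (hB : IsStarHull B) (hU : Continuous U) (hU0 : U 0 = 0) (hu : 0 < u)
  (hS : ∀ v : ℝ≥0, v ≤ u → |U v| ≤ S) (hρ₀ : 0 < ρ₀) (hBρ : Disjoint (ball (0 : ℂ) (8 * ρ₀)) B)
  (hη : stepSize S u ≤ starDeriv B * ρ₀ / 1000)

/-! ### The shift of the jets along the real axis -/

include hB hρ₀ hBρ in
/-- **`|E_B″(x) − E_B″(0)| ≤ (2/ρ₀²)|x|` for `|x| ≤ ρ₀/2`** (mean value inequality with
`|E_B‴| ≤ 2/ρ₀²` on `B̄(0, ρ₀/2)`). [folklore] -/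
theorem norm_deriv2_starMap_sub_le {z : ℂ} (hz : ‖z‖ ≤ ρ₀ / 2) :
    ‖deriv (deriv (starMap B)) z - deriv (deriv (starMap B)) 0‖ ≤ 2 / ρ₀ ^ 2 * ‖z‖ := by
  have hΦ := isRestrictionMap_starRMap hB
  obtain ⟨-, -, h3, -⟩ := norm_iteratedDeriv_hullExt_le hB hΦ hρ₀ hBρ
  have hA := (differentiableOn_starMap hB hρ₀ hBρ).analyticOnNhd isOpen_ball
  rw [← starMap_eq hB] at h3
  set s : Set ℂ := closedBall (0 : ℂ) ‖z‖ with hs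
  have hsub : s ⊆ closedBall (0 : ℂ) (ρ₀ / 2) := closedBall_subset_closedBall hz
  have hsball : s ⊆ ball (0 : ℂ) (4 * ρ₀) := hsub.trans (closedBall_subset_ball (by linarith))
  have hd : ∀ w ∈ s, HasDerivAt (deriv (deriv (starMap B))) (deriv (deriv (deriv (starMap B))) w) w :=
    fun w hw ↦ (hA.deriv.deriv w (hsball hw)).differentiableAt.hasDerivAt
  have := (convex_closedBall (0 : ℂ) ‖z‖).norm_image_sub_le_of_norm_deriv_le
    (fun w hw ↦ (hd w hw).differentiableAt) (fun w hw ↦ by rw [(hd w hw).deriv]; exact h3 w (hsub hw))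
    (mem_closedBall_self (norm_nonneg _)) (mem_closedBall_zero_iff.2 le_rfl)
  simpa using this

include hB hρ₀ hBρ in
/-- **`|E_B‴(x) − E_B‴(0)| ≤ (8/ρ₀³)|x|` for `|x| ≤ ρ₀/4`** (`|E_B⁽⁴⁾| ≤ 8/ρ₀³` on `B̄(0, ρ₀/4)`).
[folklore] -/
theorem norm_deriv3_starMap_sub_le {z : ℂ} (hz : ‖z‖ ≤ ρ₀ / 4) :
    ‖deriv (deriv (deriv (starMap B))) z - deriv (deriv (deriv (starMap B))) 0‖ ≤ 8 / ρ₀ ^ 3 * ‖z‖ := by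
  have hΦ := isRestrictionMap_starRMap hB
  obtain ⟨-, -, -, h4⟩ := norm_iteratedDeriv_hullExt_le hB hΦ hρ₀ hBρ
  have hA := (differentiableOn_starMap hB hρ₀ hBρ).analyticOnNhd isOpen_ball
  rw [← starMap_eq hB] at h4
  set s : Set ℂ := closedBall (0 : ℂ) ‖z‖ with hs
  have hsub : s ⊆ closedBall (0 : ℂ) (ρ₀ / 4) := closedBall_subset_closedBall hz
  have hsball : s ⊆ ball (0 : ℂ) (4 * ρ₀) := hsub.trans (closedBall_subset_ball (by linarith))
  have hd : ∀ w ∈ s, HasDerivAt (deriv (deriv (deriv (starMap B))))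
      (deriv (deriv (deriv (deriv (starMap B)))) w) w :=
    fun w hw ↦ (hA.deriv.deriv.deriv w (hsball hw)).differentiableAt.hasDerivAt
  have := (convex_closedBall (0 : ℂ) ‖z‖).norm_image_sub_le_of_norm_deriv_le
    (fun w hw ↦ (hd w hw).differentiableAt) (fun w hw ↦ by rw [(hd w hw).deriv]; exact h4 w (hsub hw))
    (mem_closedBall_self (norm_nonneg _)) (mem_closedBall_zero_iff.2 le_rfl)
  simpa using this

/-! ### The increments of the jets `c₂`, `c₃` over one step -/

include hB hU hU0 hu hS hρ₀ hBρ hη in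
/-- **`|c₂′ − c₂| ≤ 200u/ρ₀³ + 2|x|/ρ₀²`** (`c₂ = E_B″(0) = starJet2 B`, `c₂′ = E_{B′}″(0)`,
`x = U_u`): `|E_{B′}″(0) − E_B″(x)| ≤ 200u/ρ₀³` (`norm_deriv2_starStep_le` at `z = x`) and
`|E_B″(x) − E_B″(0)| ≤ (2/ρ₀²)|x|`. [cite: Lawler2005, §4.6.1 (4.35)–(4.37)] -/
theorem abs_starJet2_slidHull_sub_le :
    |starJet2 (slidHull U B u) - starJet2 B| ≤ 200 * u / ρ₀ ^ 3 + 2 / ρ₀ ^ 2 * |U u| := by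
  obtain ⟨hUu, hη1, hη0⟩ := abs_driver_le hB hu hS hρ₀ hη
  have hx4 : ‖((U u : ℝ) : ℂ)‖ ≤ ρ₀ / 4 := by
    rw [norm_real, Real.norm_eq_abs]; linarith
  have hx2 : ‖((U u : ℝ) : ℂ)‖ ≤ ρ₀ / 2 := by linarith
  have h1 := (norm_deriv2_starStep_le hB hU hU0 hu hS hρ₀ hBρ hη).1 ((U u : ℝ) : ℂ) hx4
  rw [sub_self] at h1
  have h2 := norm_deriv2_starMap_sub_le hB hρ₀ hBρ hx2
  rw [norm_real, Real.norm_eq_abs] at h2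
  have h3 : ‖deriv (deriv (starMap (slidHull U B u))) 0 - deriv (deriv (starMap B)) 0‖ ≤
      200 * u / ρ₀ ^ 3 + 2 / ρ₀ ^ 2 * |U u| := by
    calc _ = ‖(deriv (deriv (starMap (slidHull U B u))) 0 - deriv (deriv (starMap B)) (U u)) +
          (deriv (deriv (starMap B)) (U u) - deriv (deriv (starMap B)) 0)‖ := by ring_nf
      _ ≤ _ := norm_add_le _ _
      _ ≤ _ := add_le_add h1 h2
  rw [starJet2, starJet2, ← sub_re]
  exact (abs_re_le_norm _).trans h3

include hB hU hU0 hu hS hρ₀ hBρ hη in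
/-- **`|c₃′ − c₃| ≤ 1600u/ρ₀⁴ + 8|x|/ρ₀³`** (`c₃ = E_B‴(0) = starJet3 B`).
[cite: Lawler2005, §4.6.1 (4.35)–(4.37)] -/
theorem abs_starJet3_slidHull_sub_le :
    |starJet3 (slidHull U B u) - starJet3 B| ≤ 1600 * u / ρ₀ ^ 4 + 8 / ρ₀ ^ 3 * |U u| := by
  obtain ⟨hUu, hη1, hη0⟩ := abs_driver_le hB hu hS hρ₀ hη
  have hx8 : ‖((U u : ℝ) : ℂ)‖ ≤ ρ₀ / 8 := by
    rw [norm_real, Real.norm_eq_abs]; linarith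
  have hx4 : ‖((U u : ℝ) : ℂ)‖ ≤ ρ₀ / 4 := by linarith
  have h1 := (norm_deriv2_starStep_le hB hU hU0 hu hS hρ₀ hBρ hη).2 ((U u : ℝ) : ℂ) hx8
  rw [sub_self] at h1
  have h2 := norm_deriv3_starMap_sub_le hB hρ₀ hBρ hx4
  rw [norm_real, Real.norm_eq_abs] at h2
  have h3 : ‖deriv (deriv (deriv (starMap (slidHull U B u)))) 0 - deriv (deriv (deriv (starMap B))) 0‖ ≤
      1600 * u / ρ₀ ^ 4 + 8 / ρ₀ ^ 3 * |U u| := by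
    calc _ = ‖(deriv (deriv (deriv (starMap (slidHull U B u)))) 0 - deriv (deriv (deriv (starMap B))) (U u)) +
          (deriv (deriv (deriv (starMap B))) (U u) - deriv (deriv (deriv (starMap B))) 0)‖ := by ring_nf
      _ ≤ _ := norm_add_le _ _
      _ ≤ _ := add_le_add h1 h2
  rw [starJet3, starJet3, ← sub_re]
  exact (abs_re_le_norm _).trans h3

include hB hU hU0 hu hS hρ₀ hBρ hη in
/-- **A priori bounds for the jets of the slid hull**: `|c₂′| ≤ 2/ρ₀`, `|c₃′| ≤ 4/ρ₀²`
(`B′` misses `B(0, 6ρ₀)`, `disjoint_ball_slidHull`, and `starJet_spec` with radius `3ρ₀/4`).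
[folklore] -/
theorem abs_starJet_slidHull_le :
    |starJet2 (slidHull U B u)| ≤ 2 / ρ₀ ∧ |starJet3 (slidHull U B u)| ≤ 4 / ρ₀ ^ 2 := by
  obtain ⟨hηρ, hB'⟩ := isStarHull_slidHull_canonical hB hU hU0 hS hρ₀ hBρ hη
  have hdisj : Disjoint (ball (0 : ℂ) (8 * (3 * ρ₀ / 4))) (slidHull U B u) := by
    rw [show 8 * (3 * ρ₀ / 4) = 2 * (3 * ρ₀) by ring]
    exact disjoint_ball_slidHull hU hu hS hBρ hηρ
  obtain ⟨-, -, hc2, hc3, -⟩ := starJet_spec hB' (by positivity : 0 < 3 * ρ₀ / 4) hdisj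
  constructor
  · refine hc2.trans ?_
    rw [div_le_div_iff₀ (by positivity) hρ₀]; nlinarith
  · refine hc3.trans ?_
    rw [div_le_div_iff₀ (by positivity) (by positivity)]; nlinarith [sq_nonneg ρ₀]

/-! ### The Schwarzian mass and its increment over one step -/

/-- **The size of the Schwarzian mass on the controlled class**: for `δ₀ ≤ d`, `|c₂| ≤ 1/ρ₀`,
`|c₃| ≤ 2/ρ₀²`, `|c₂²/(4d²) − c₃/(6d)| ≤ 1/(4 δ₀² ρ₀²) + 1/(3 δ₀ ρ₀²)`. [folklore] -/
theorem abs_schwarzMass_le {d c₂ c₃ δ₀ ρ₀ : ℝ} (hδ0 : 0 < δ₀) (hρ₀ : 0 < ρ₀) (hδ : δ₀ ≤ d)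
    (hc2 : |c₂| ≤ 1 / ρ₀) (hc3 : |c₃| ≤ 2 / ρ₀ ^ 2) :
    |bubbleMass d (c₂ / 2) (c₃ / 6)| ≤ 1 / (4 * δ₀ ^ 2 * ρ₀ ^ 2) + 1 / (3 * δ₀ * ρ₀ ^ 2) := by
  have hd0 : 0 < d := hδ0.trans_le hδ
  rw [bubbleMass]
  have e1 : |(c₂ / 2) ^ 2 / d ^ 2| ≤ 1 / (4 * δ₀ ^ 2 * ρ₀ ^ 2) := by
    rw [abs_div, abs_of_nonneg (sq_nonneg _), abs_of_pos (by positivity : (0 : ℝ) < d ^ 2),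
      div_le_div_iff₀ (by positivity) (by positivity)]
    have hc2' : c₂ ^ 2 ≤ (1 / ρ₀) ^ 2 := by rw [← sq_abs]; exact pow_le_pow_left₀ (abs_nonneg _) hc2 2
    have hdd : δ₀ ^ 2 ≤ d ^ 2 := pow_le_pow_left₀ hδ0.le hδ 2
    have h1 : (c₂ / 2) ^ 2 * (4 * δ₀ ^ 2 * ρ₀ ^ 2) = (c₂ ^ 2 * ρ₀ ^ 2) * δ₀ ^ 2 := by ring
    have h2 : c₂ ^ 2 * ρ₀ ^ 2 ≤ 1 := by
      have := mul_le_mul_of_nonneg_right hc2' (sq_nonneg ρ₀)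
      rwa [show (1 / ρ₀) ^ 2 * ρ₀ ^ 2 = 1 by field_simp] at this
    rw [h1, one_mul]
    calc c₂ ^ 2 * ρ₀ ^ 2 * δ₀ ^ 2 ≤ 1 * δ₀ ^ 2 := mul_le_mul_of_nonneg_right h2 (sq_nonneg _)
      _ ≤ d ^ 2 := by rw [one_mul]; exact hdd
  have e2 : |c₃ / 6 / d| ≤ 1 / (3 * δ₀ * ρ₀ ^ 2) := by
    rw [abs_div, abs_div, abs_of_pos hd0, show |(6 : ℝ)| = 6 by norm_num,
      div_le_div_iff₀ (by positivity) (by positivity)]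
    have h1 : |c₃| / 6 * (3 * δ₀ * ρ₀ ^ 2) = (|c₃| * ρ₀ ^ 2) * δ₀ / 2 := by ring
    have h2 : |c₃| * ρ₀ ^ 2 ≤ 2 := by
      have := mul_le_mul_of_nonneg_right hc3 (sq_nonneg ρ₀)
      rwa [show 2 / ρ₀ ^ 2 * ρ₀ ^ 2 = 2 by field_simp] at this
    rw [h1]
    nlinarith [abs_nonneg c₃, sq_nonneg ρ₀]
  exact (abs_sub _ _).trans (add_le_add e1 e2)

/-- **Lipschitz continuity of the Schwarzian mass in the jets**: on `d, d′ ≥ δ₁ > 0`,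
`|c₂|, |c₂′| ≤ C₂`, `|c₃| ≤ C₃`,
`|m′ − m| ≤ (2C₂/(4δ₁²)) |c₂′ − c₂| + (C₂² (d + d′)/(4 δ₁⁴)) |d′ − d| + |c₃′ − c₃|/(6δ₁) + (C₃/(6δ₁²)) |d′ − d|`
(`m = c₂²/(4d²) − c₃/(6d)`). [folklore] -/
theorem abs_schwarzMass_sub_le {d d' c₂ c₂' c₃ c₃' δ₁ C₂ C₃ : ℝ} (hδ1 : 0 < δ₁) (hd : δ₁ ≤ d) (hd' : δ₁ ≤ d')
    (hc2 : |c₂| ≤ C₂) (hc2' : |c₂'| ≤ C₂) (hc3 : |c₃| ≤ C₃) :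
    |bubbleMass d' (c₂' / 2) (c₃' / 6) - bubbleMass d (c₂ / 2) (c₃ / 6)| ≤
      2 * C₂ / (4 * δ₁ ^ 2) * |c₂' - c₂| + C₂ ^ 2 * (d + d') / (4 * δ₁ ^ 4) * |d' - d| +
        |c₃' - c₃| / (6 * δ₁) + C₃ / (6 * δ₁ ^ 2) * |d' - d| := by
  have hd0 : 0 < d := hδ1.trans_le hd
  have hd0' : 0 < d' := hδ1.trans_le hd'
  have hC2 : 0 ≤ C₂ := (abs_nonneg _).trans hc2
  have hC3 : 0 ≤ C₃ := (abs_nonneg _).trans hc3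
  -- decomposition
  have hdec : bubbleMass d' (c₂' / 2) (c₃' / 6) - bubbleMass d (c₂ / 2) (c₃ / 6) =
      (c₂' + c₂) * (c₂' - c₂) / (4 * d' ^ 2) + c₂ ^ 2 * ((d + d') * (d - d')) / (4 * d ^ 2 * d' ^ 2) -
        (c₃' - c₃) / (6 * d') - c₃ * (d - d') / (6 * d * d') := by
    rw [bubbleMass, bubbleMass]
    field_simp
    ring
  rw [hdec]
  -- the four pieces
  have p1 : |(c₂' + c₂) * (c₂' - c₂) / (4 * d' ^ 2)| ≤ 2 * C₂ / (4 * δ₁ ^ 2) * |c₂' - c₂| := by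
    rw [abs_div, abs_mul, abs_of_pos (by positivity : (0 : ℝ) < 4 * d' ^ 2)]
    have h1 : |c₂' + c₂| ≤ 2 * C₂ := (abs_add_le _ _).trans (by linarith)
    have h2 : 4 * δ₁ ^ 2 ≤ 4 * d' ^ 2 := by nlinarith
    calc |c₂' + c₂| * |c₂' - c₂| / (4 * d' ^ 2) ≤ 2 * C₂ * |c₂' - c₂| / (4 * d' ^ 2) :=
          div_le_div_of_nonneg_right (mul_le_mul_of_nonneg_right h1 (abs_nonneg _)) (by positivity)
      _ ≤ 2 * C₂ * |c₂' - c₂| / (4 * δ₁ ^ 2) :=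
          div_le_div_of_nonneg_left (by positivity) (by positivity) h2
      _ = _ := by ring
  have p2 : |c₂ ^ 2 * ((d + d') * (d - d')) / (4 * d ^ 2 * d' ^ 2)| ≤ C₂ ^ 2 * (d + d') / (4 * δ₁ ^ 4) * |d' - d| := by
    rw [abs_div, abs_mul, abs_mul, abs_of_nonneg (sq_nonneg c₂), abs_of_pos (by positivity : (0 : ℝ) < d + d'),
      abs_of_pos (by positivity : (0 : ℝ) < 4 * d ^ 2 * d' ^ 2), abs_sub_comm]
    have h1 : c₂ ^ 2 ≤ C₂ ^ 2 := by rw [← sq_abs]; exact pow_le_pow_left₀ (abs_nonneg _) hc2 2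
    have h2 : 4 * δ₁ ^ 4 ≤ 4 * d ^ 2 * d' ^ 2 := by
      have e1 : δ₁ ^ 2 ≤ d ^ 2 := pow_le_pow_left₀ hδ1.le hd 2
      have e2 : δ₁ ^ 2 ≤ d' ^ 2 := pow_le_pow_left₀ hδ1.le hd' 2
      have := mul_le_mul e1 e2 (by positivity) (by positivity)
      nlinarith [this]
    calc c₂ ^ 2 * ((d + d') * |d' - d|) / (4 * d ^ 2 * d' ^ 2) ≤ C₂ ^ 2 * ((d + d') * |d' - d|) / (4 * d ^ 2 * d' ^ 2) :=
          div_le_div_of_nonneg_right (mul_le_mul_of_nonneg_right h1 (by positivity)) (by positivity)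
      _ ≤ C₂ ^ 2 * ((d + d') * |d' - d|) / (4 * δ₁ ^ 4) :=
          div_le_div_of_nonneg_left (by positivity) (by positivity) h2
      _ = _ := by ring
  have p3 : |(c₃' - c₃) / (6 * d')| ≤ |c₃' - c₃| / (6 * δ₁) := by
    rw [abs_div, abs_of_pos (by positivity : (0 : ℝ) < 6 * d')]
    exact div_le_div_of_nonneg_left (abs_nonneg _) (by positivity) (by nlinarith)
  have p4 : |c₃ * (d - d') / (6 * d * d')| ≤ C₃ / (6 * δ₁ ^ 2) * |d' - d| := by
    rw [abs_div, abs_mul, abs_of_pos (by positivity : (0 : ℝ) < 6 * d * d'), abs_sub_comm]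
    have h2 : 6 * δ₁ ^ 2 ≤ 6 * d * d' := by
      have := mul_le_mul hd hd' hδ1.le hd0.le
      nlinarith [this]
    calc |c₃| * |d' - d| / (6 * d * d') ≤ C₃ * |d' - d| / (6 * d * d') :=
          div_le_div_of_nonneg_right (mul_le_mul_of_nonneg_right hc3 (abs_nonneg _)) (by positivity)
      _ ≤ C₃ * |d' - d| / (6 * δ₁ ^ 2) := div_le_div_of_nonneg_left (by positivity) (by positivity) h2
      _ = _ := by ring
  have := abs_sub (((c₂' + c₂) * (c₂' - c₂) / (4 * d' ^ 2) + c₂ ^ 2 * ((d + d') * (d - d')) / (4 * d ^ 2 * d' ^ 2) -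
    (c₃' - c₃) / (6 * d'))) (c₃ * (d - d') / (6 * d * d'))
  have := abs_sub ((c₂' + c₂) * (c₂' - c₂) / (4 * d' ^ 2) + c₂ ^ 2 * ((d + d') * (d - d')) / (4 * d ^ 2 * d' ^ 2))
    ((c₃' - c₃) / (6 * d'))
  have := abs_add_le ((c₂' + c₂) * (c₂' - c₂) / (4 * d' ^ 2)) (c₂ ^ 2 * ((d + d') * (d - d')) / (4 * d ^ 2 * d' ^ 2))
  linarith

/-- **The constant of the one-step increment of the Schwarzian mass** on the controlled class
(`δ₀ ≤ d`, hull off `B(0, 8ρ₀)`): the sum of the `u`- and `η`-coefficients of the bound of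
`abs_schwarzMass_slidHull_sub_le`. [folklore] -/
def massStepC (δ₀ ρ₀ : ℝ) : ℝ :=
  (2 * (2 / ρ₀) / (4 * (δ₀ / 2) ^ 2)) * (200 / ρ₀ ^ 3 + 2 / ρ₀ ^ 2) +
    ((2 / ρ₀) ^ 2 * 3 / (4 * (δ₀ / 2) ^ 4)) * (50 / ρ₀ ^ 2 + 2 / ρ₀) +
    (1 / (6 * (δ₀ / 2))) * (1600 / ρ₀ ^ 4 + 8 / ρ₀ ^ 3) +
    ((2 / ρ₀ ^ 2) / (6 * (δ₀ / 2) ^ 2)) * (50 / ρ₀ ^ 2 + 2 / ρ₀)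

/-- `0 ≤ massStepC δ₀ ρ₀`. [folklore] -/
theorem massStepC_nonneg {δ₀ ρ₀ : ℝ} (hδ0 : 0 < δ₀) (hρ₀ : 0 < ρ₀) : 0 ≤ massStepC δ₀ ρ₀ := by
  unfold massStepC; positivity

include hB hU hU0 hu hS hρ₀ hBρ hη in
/-- **The Schwarzian mass moves by `O(u + η)` over one step**: on the controlled class
(`δ₀ ≤ Φ′_B(0)`), with `η = stepSize S u`,
`|m(B′) − m(B)| ≤ massStepC δ₀ ρ₀ · (u + η)`, `m(B) = c₂²/(4d²) − c₃/(6d) = −SE_B(0)/6`.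
[cite: LawlerSchrammWerner2003Restriction, Prop. 5.3 (the compensator ∫ Sh_s(W_s)/6 ds)] -/
theorem abs_schwarzMass_slidHull_sub_le {δ₀ : ℝ} (hδ0 : 0 < δ₀) (hδ : δ₀ ≤ starDeriv B) :
    |bubbleMass (starDeriv (slidHull U B u)) (starJet2 (slidHull U B u) / 2) (starJet3 (slidHull U B u) / 6) -
        bubbleMass (starDeriv B) (starJet2 B / 2) (starJet3 B / 6)| ≤
      massStepC δ₀ ρ₀ * (u + stepSize S u) := by
  obtain ⟨hUu, hη1, hη0⟩ := abs_driver_le hB hu hS hρ₀ hη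
  obtain ⟨hd0, hd1, -⟩ := starDeriv_spec hB
  obtain ⟨-, -, hc2, hc3, -⟩ := starJet_spec hB hρ₀ hBρ
  obtain ⟨hc2', hc3'⟩ := abs_starJet_slidHull_le hB hU hU0 hu hS hρ₀ hBρ hη
  obtain ⟨hcrude, hsmall⟩ := abs_starDeriv_sub_le_crude hB hU hU0 hu hS hρ₀ hBρ hη
  have hΔ2 := abs_starJet2_slidHull_sub_le hB hU hU0 hu hS hρ₀ hBρ hη
  have hΔ3 := abs_starJet3_slidHull_sub_le hB hU hU0 hu hS hρ₀ hBρ hη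
  have hu0 : (0 : ℝ) ≤ u := u.coe_nonneg
  set d := starDeriv B with hd
  set d' := starDeriv (slidHull U B u) with hd'
  -- `d' ≥ d/2 ≥ δ₀/2`, `d + d' ≤ 3`
  have hdd' : |d' - d| ≤ d / 400 := hcrude.trans hsmall
  have hd'ge : δ₀ / 2 ≤ d' := by
    have := neg_abs_le (d' - d); linarith
  have hdge : δ₀ / 2 ≤ d := by linarith
  have hsum3 : d + d' ≤ 3 := by
    have := le_abs_self (d' - d); linarith
  -- jets bounds with common constants `C₂ = 2/ρ₀`, `C₃ = 2/ρ₀²`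
  have hc2w : |starJet2 B| ≤ 2 / ρ₀ := hc2.trans (by rw [div_le_div_iff₀ hρ₀ hρ₀]; nlinarith)
  have key := abs_schwarzMass_sub_le (c₃' := starJet3 (slidHull U B u)) (C₂ := 2 / ρ₀) (C₃ := 2 / ρ₀ ^ 2)
    (by positivity : 0 < δ₀ / 2) hdge hd'ge hc2w hc2' hc3
  -- substitute the increments
  have hx : |U u| ≤ stepSize S u := hUu
  have q1 : 2 * (2 / ρ₀) / (4 * (δ₀ / 2) ^ 2) * |starJet2 (slidHull U B u) - starJet2 B| ≤
      2 * (2 / ρ₀) / (4 * (δ₀ / 2) ^ 2) * (200 / ρ₀ ^ 3 + 2 / ρ₀ ^ 2) * (u + stepSize S u) := by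
    rw [mul_assoc]
    refine mul_le_mul_of_nonneg_left ?_ (by positivity)
    calc |starJet2 (slidHull U B u) - starJet2 B| ≤ 200 * u / ρ₀ ^ 3 + 2 / ρ₀ ^ 2 * |U u| := hΔ2
      _ ≤ 200 / ρ₀ ^ 3 * (u + stepSize S u) + 2 / ρ₀ ^ 2 * (u + stepSize S u) := by
          have e1 : 200 * (u : ℝ) / ρ₀ ^ 3 = 200 / ρ₀ ^ 3 * u := by ring
          have e2 : 200 / ρ₀ ^ 3 * (u : ℝ) ≤ 200 / ρ₀ ^ 3 * (u + stepSize S u) :=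
            mul_le_mul_of_nonneg_left (by linarith) (by positivity)
          have e3 : 2 / ρ₀ ^ 2 * |U u| ≤ 2 / ρ₀ ^ 2 * (u + stepSize S u) :=
            mul_le_mul_of_nonneg_left (by linarith) (by positivity)
          linarith
      _ = _ := by ring
  have q2 : (2 / ρ₀) ^ 2 * (d + d') / (4 * (δ₀ / 2) ^ 4) * |d' - d| ≤
      (2 / ρ₀) ^ 2 * 3 / (4 * (δ₀ / 2) ^ 4) * (50 / ρ₀ ^ 2 + 2 / ρ₀) * (u + stepSize S u) := by
    have e1 : (2 / ρ₀) ^ 2 * (d + d') / (4 * (δ₀ / 2) ^ 4) ≤ (2 / ρ₀) ^ 2 * 3 / (4 * (δ₀ / 2) ^ 4) := by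
      refine div_le_div_of_nonneg_right ?_ (by positivity)
      exact mul_le_mul_of_nonneg_left hsum3 (by positivity)
    have e2 : |d' - d| ≤ (50 / ρ₀ ^ 2 + 2 / ρ₀) * (u + stepSize S u) := by
      calc |d' - d| ≤ 50 * u / ρ₀ ^ 2 + 2 * stepSize S u / ρ₀ := hcrude
        _ ≤ 50 / ρ₀ ^ 2 * (u + stepSize S u) + 2 / ρ₀ * (u + stepSize S u) := by
            have f1 : 50 * (u : ℝ) / ρ₀ ^ 2 = 50 / ρ₀ ^ 2 * u := by ring
            have f2 : 2 * stepSize S u / ρ₀ = 2 / ρ₀ * stepSize S u := by ring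
            have f3 : 50 / ρ₀ ^ 2 * (u : ℝ) ≤ 50 / ρ₀ ^ 2 * (u + stepSize S u) :=
              mul_le_mul_of_nonneg_left (by linarith) (by positivity)
            have f4 : 2 / ρ₀ * stepSize S u ≤ 2 / ρ₀ * (u + stepSize S u) :=
              mul_le_mul_of_nonneg_left (by linarith) (by positivity)
            linarith
        _ = _ := by ring
    calc _ ≤ (2 / ρ₀) ^ 2 * 3 / (4 * (δ₀ / 2) ^ 4) * |d' - d| := mul_le_mul_of_nonneg_right e1 (abs_nonneg _)
      _ ≤ (2 / ρ₀) ^ 2 * 3 / (4 * (δ₀ / 2) ^ 4) * ((50 / ρ₀ ^ 2 + 2 / ρ₀) * (u + stepSize S u)) :=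
          mul_le_mul_of_nonneg_left e2 (by positivity)
      _ = _ := by ring
  have q3 : |starJet3 (slidHull U B u) - starJet3 B| / (6 * (δ₀ / 2)) ≤
      1 / (6 * (δ₀ / 2)) * (1600 / ρ₀ ^ 4 + 8 / ρ₀ ^ 3) * (u + stepSize S u) := by
    rw [div_eq_mul_one_div, mul_comm, mul_assoc]
    refine mul_le_mul_of_nonneg_left ?_ (by positivity)
    calc |starJet3 (slidHull U B u) - starJet3 B| ≤ 1600 * u / ρ₀ ^ 4 + 8 / ρ₀ ^ 3 * |U u| := hΔ3
      _ ≤ 1600 / ρ₀ ^ 4 * (u + stepSize S u) + 8 / ρ₀ ^ 3 * (u + stepSize S u) := by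
          have e1 : 1600 * (u : ℝ) / ρ₀ ^ 4 = 1600 / ρ₀ ^ 4 * u := by ring
          have e2 : 1600 / ρ₀ ^ 4 * (u : ℝ) ≤ 1600 / ρ₀ ^ 4 * (u + stepSize S u) :=
            mul_le_mul_of_nonneg_left (by linarith) (by positivity)
          have e3 : 8 / ρ₀ ^ 3 * |U u| ≤ 8 / ρ₀ ^ 3 * (u + stepSize S u) :=
            mul_le_mul_of_nonneg_left (by linarith) (by positivity)
          linarith
      _ = _ := by ring
  have q4 : 2 / ρ₀ ^ 2 / (6 * (δ₀ / 2) ^ 2) * |d' - d| ≤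
      2 / ρ₀ ^ 2 / (6 * (δ₀ / 2) ^ 2) * (50 / ρ₀ ^ 2 + 2 / ρ₀) * (u + stepSize S u) := by
    rw [mul_assoc]
    refine mul_le_mul_of_nonneg_left ?_ (by positivity)
    calc |d' - d| ≤ 50 * u / ρ₀ ^ 2 + 2 * stepSize S u / ρ₀ := hcrude
      _ ≤ 50 / ρ₀ ^ 2 * (u + stepSize S u) + 2 / ρ₀ * (u + stepSize S u) := by
          have f3 : 50 / ρ₀ ^ 2 * (u : ℝ) ≤ 50 / ρ₀ ^ 2 * (u + stepSize S u) :=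
            mul_le_mul_of_nonneg_left (by linarith) (by positivity)
          have f4 : 2 / ρ₀ * stepSize S u ≤ 2 / ρ₀ * (u + stepSize S u) :=
            mul_le_mul_of_nonneg_left (by linarith) (by positivity)
          have f1 : 50 * (u : ℝ) / ρ₀ ^ 2 = 50 / ρ₀ ^ 2 * u := by ring
          have f2 : 2 * stepSize S u / ρ₀ = 2 / ρ₀ * stepSize S u := by ring
          linarith
      _ = _ := by ring
  have htot : 2 * (2 / ρ₀) / (4 * (δ₀ / 2) ^ 2) * (200 / ρ₀ ^ 3 + 2 / ρ₀ ^ 2) * (u + stepSize S u) +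
      (2 / ρ₀) ^ 2 * 3 / (4 * (δ₀ / 2) ^ 4) * (50 / ρ₀ ^ 2 + 2 / ρ₀) * (u + stepSize S u) +
      1 / (6 * (δ₀ / 2)) * (1600 / ρ₀ ^ 4 + 8 / ρ₀ ^ 3) * (u + stepSize S u) +
      2 / ρ₀ ^ 2 / (6 * (δ₀ / 2) ^ 2) * (50 / ρ₀ ^ 2 + 2 / ρ₀) * (u + stepSize S u) =
      massStepC δ₀ ρ₀ * (u + stepSize S u) := by
    rw [massStepC]; ring
  linarith [key, q1, q2, q3, q4, htot]

end Loewner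

end Literature.Probability.RandomPlanarGeometry

end
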